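import Literature.NumberTheory.EllipticCurves.FormalGroupDivision
import Literature.NumberTheory.EllipticCurves.FormalGroupChartLimitLogEquivarianceProofs
import HarnessLib

/-!
# The limit logarithm maps the level `U_ρ` ONTO the ball `B_ρ` for `ρ ≤ |p|²`
# (successive approximation; the surjectivity half of Silverman IV.6.4(b), power-series-free)

`Proofs` file (theorems only, no definitions, no named facts) in topic `NumberTheory/EllipticCurves`,
namespace `Literature.NumberTheory.EllipticCurves.FormalGroupChart`, continuing
`FormalGroupChartLimitLog{Proofs, EquivarianceProofs}` (the limit logarithm `ℓ` on the level
`E⁽ᵖ⁾ = {Q ∈ E₁ : |z Q| ≤ |p|}` of a `w`-integral Weierstrass equation over a valued field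
`(F, w)`, delivered as "any function with (SPEC)") and `FormalGroupDivision` (the filtration
`kernelLevel w V ρ = U_ρ`, division by `N` via successive approximation).  Those files list the
SURJECTIVITY of `ℓ : E⁽ᵖ⁾ → p𝒪` as "NOT here (needs Hensel)"; this file supplies it one level down:

* `exists_limitLog_eq_of_val_le` — **for `ρ ≤ |p|²` and `|y| ≤ ρ` there is `Q ∈ E₁` with
  `|z(Q)| ≤ ρ` and `ℓ(Q) = y`**, granted (i) `hlift`: every `a` with `|a| ≤ ρ` is a parameter
  `z(P)`, `P ∈ E₁` (Hensel; for the completion of a number field this is the tree's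
  `LocalPoints.hlift`) and (ii) `hcomplete`: geometric Cauchy sequences converge (for `K_v`:
  `LocalPoints.exists_limit_of_geometric`) — the same two analytic inputs as
  `FormalGroupChart.exists_nsmul_eq_of_val_le_mul`;
* `image_limitLog_kernelLevel_eq` — hence **`ℓ(U_ρ) = B_ρ = {y : |y| ≤ ρ}`** for `ρ ≤ |p|²`
  (`⊆` is `val_limitLog_le`).

The threshold `|p|²` (instead of Silverman's sharp `r > v(p)/(p − 1)`, Thm. IV.6.4(b):
`log : Ê(𝓜ʳ) ≅ 𝓜ʳ`) is what the tree's quadratic estimate `|ℓ(Q) − z(Q)| ≤ |z(Q)|²/|p|`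
(`val_limitLog_sub_zCoord_le`) affords: it makes `y ↦ y − ℓ(z⁻¹ y)` a contraction by the factor
`ρ/|p| ≤ |p| < 1`.  For an UNRAMIFIED `p`-adic field (`E₁ = E⁽ᵖ⁾ = U_{|p|}`) the top layer
`U_{|p|}/U_{|p|²} ≅ 𝒪/p` is then handled by counting (`FormalGroupDivision.relIndex_kernelLevel_eq`)
in the consumer (cell `bsd-addord`, the E-side lattice lemma `log_ω E(K) = E_p(φ)⁻¹𝒪_K`).

## The argument (`exists_limitLog_eq_of_val_le`)

With `θ = ρ/|p|`: keep a residual `r_k` (`|r_k| ≤ ρ θ^k`) and a partial sum `S_k ∈ U_ρ` with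
`y = r_k + ℓ(S_k)`; lift `Q_k = z⁻¹(r_k)` and pass to `S_{k+1} = S_k + Q_k`,
`r_{k+1} = r_k − ℓ(Q_k) = −(ℓ(Q_k) − z(Q_k))`, of size `≤ |r_k|²/|p| ≤ ρ θ^{k+1}`
(additivity `limitLog_add` keeps `y = r_{k+1} + ℓ(S_{k+1})`).  The parameters `z(S_k)` are Cauchy
(`|z(S + Q) − z(S)| = |z(Q)|`, `val_zCoord_add_sub_eq`), converge to some `y∞` with `|y∞| ≤ ρ`,
and the point `P = z⁻¹(y∞)` has `|ℓ(P) − y| ≤ max(|ℓ(P − S_k)|, |r_k|) ≤ ρ θ^k` for every `k`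
(`|ℓ| ≤ |z|` on the level, `val_limitLog_le`; `|z P − z S_k| = |z(P − S_k)|`, `val_zCoord_sub`),
hence `ℓ(P) = y`.

## References

* [SilvermanAEC2009] J. H. Silverman, *The Arithmetic of Elliptic Curves*, 2nd ed., GTM 106
  (2009): Thm. IV.6.4(b) (`log : Ê(𝓜ʳ) ⥲ 𝓜ʳ`), Prop. IV.3.2, Prop. VII.2.2 (`E₁(K) ≅ Ê(𝓜)`).

## Design

`noncomputable section`, `open scoped Classical NNReal`; stated for an arbitrary function `ℓ` with
(SPEC) (so it applies to `limitLog` through `limitLog_spec` / `limitLog_spec_of_completeSpace` and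
to `WeierstrassCurve.padicLimitLog` over `ℚ_p`), with the analytic inputs (i), (ii) as hypotheses
exactly in the shape of `FormalGroupDivision`.  Axioms: `propext`, `Classical.choice`, `Quot.sound`.
-/
noncomputable section

open scoped Classical NNReal

namespace Literature.NumberTheory.EllipticCurves.FormalGroupChart

universe u

variable {F : Type u} [Field F] {w : Valuation F ℝ≥0} {V : WeierstrassCurve F}
  [hV : V.IsIntegral w.integer] {p : ℕ} {ℓ : V.toAffine.Point → F}

/-- **The logarithm is onto the ball `B_ρ` from the level `U_ρ`, `ρ ≤ |p|²`, over a complete field.**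
For every `y` with `|y| ≤ ρ ≤ |p|²` there is `Q ∈ E₁` with `|z(Q)| ≤ ρ` and `ℓ(Q) = y`, for any
function `ℓ` with (SPEC) on `E⁽ᵖ⁾` (e.g. `limitLog`), granted (i) every `a` with `|a| ≤ ρ` is a
parameter `z(P)`, `P ∈ E₁` (Hensel, `hlift`) and (ii) geometric Cauchy sequences converge
(`hcomplete`).  Successive approximation: `Q₀ = z⁻¹(y)`, `y₁ = y − ℓ(Q₀)` has
`|y₁| = |ℓ(Q₀) − z(Q₀)| ≤ |y|²/|p| ≤ (ρ/|p|)·|y|` (`val_limitLog_sub_zCoord_le`), and the partial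
sums `Q₀ + Q₁ + ⋯` have Cauchy parameters (`|z(S + Q) − z(S)| = |z(Q)|`); the limit point `P`
satisfies `|ℓ(P) − y| ≤ ρ (ρ/|p|)^k` for all `k`.  (Silverman IV.6.4(b) proves the bijectivity
`Ê(𝓜ʳ) ≅ 𝓜ʳ` through the formal exponential; here power-series-free, one level lower than sharp.)
[cite: SilvermanAEC2009, Thm. IV.6.4(b)] -/
theorem exists_limitLog_eq_of_val_le (hp0 : (p : F) ≠ 0) (hp1 : w (p : F) < 1)
    (hℓ : ∀ Q ∈ level w V (w (p : F)), ∀ r : ℕ,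
      w (ℓ Q - ((p ^ r) • Q).zCoord / (p : F) ^ r) ≤ w (p : F) ^ (r + 1))
    {ρ : ℝ≥0} (hρ : ρ ≤ w (p : F) ^ 2)
    (hlift : ∀ a : F, w a ≤ ρ → ∃ P ∈ kernel w V, P.zCoord = a)
    (hcomplete : ∀ (x : ℕ → F) (C θ : ℝ≥0), θ < 1 → (∀ k, w (x (k + 1) - x k) ≤ C * θ ^ k) →
      ∃ y : F, ∀ k, w (y - x k) ≤ C * θ ^ k)
    {y : F} (hy : w y ≤ ρ) :
    ∃ Q ∈ kernel w V, w Q.zCoord ≤ ρ ∧ ℓ Q = y := by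
  have hp : 0 < w (p : F) := (Valuation.pos_iff w).mpr hp0
  -- the contraction factor `θ = ρ/|p| ≤ |p| < 1`
  set θ : ℝ≥0 := ρ / w (p : F) with hθ
  have hθp : θ ≤ w (p : F) := by
    rw [hθ, div_le_iff₀ hp, ← pow_two]; exact hρ
  have hθ1 : θ < 1 := hθp.trans_lt hp1
  have hθ1' : θ ≤ 1 := hθ1.le
  have hρp : ρ ≤ w (p : F) := hρ.trans (by rw [pow_two]; exact mul_le_of_le_one_left' hp1.le)
  have hρθ : ρ = θ * w (p : F) := by rw [hθ, div_mul_cancel₀ ρ hp.ne']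
  -- points of `U_ρ` are in the level `E⁽ᵖ⁾`
  have hlev : ∀ {Q : V.toAffine.Point}, Q ∈ kernel w V → w Q.zCoord ≤ ρ →
      Q ∈ level w V (w (p : F)) := fun hQ hQz ↦ ⟨hQ, hQz.trans hρp⟩
  -- invariant at level `k`: residual `s.1 : F`, partial sum `s.2`
  let Inv : ℕ → F × V.toAffine.Point → Prop := fun k s ↦
    s.2 ∈ kernel w V ∧ w s.2.zCoord ≤ ρ ∧ w s.1 ≤ ρ * θ ^ k ∧ y = s.1 + ℓ s.2
  have hℓ0 : ℓ 0 = 0 := limitLog_zero hp0 hp1 hℓ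
  have hInv0 : Inv 0 (y, 0) := by
    refine ⟨(kernel w V).zero_mem, ?_, by rwa [pow_zero, mul_one], ?_⟩
    · change w (0 : V.toAffine.Point).zCoord ≤ ρ
      rw [WeierstrassCurve.Affine.Point.zCoord_zero, map_zero]; exact zero_le
    · change y = y + ℓ 0
      rw [hℓ0, add_zero]
  -- the step
  have hstep : ∀ (k : ℕ) (s : {s // Inv k s}), ∃ s' : {s' // Inv (k + 1) s'},
      w (s'.1.2.zCoord - s.1.2.zCoord) ≤ ρ * θ ^ k := by
    rintro k ⟨⟨r, S⟩, hSK, hSz, hrz, hyS⟩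
    dsimp only at hSK hSz hrz hyS
    have hrρ : w r ≤ ρ := hrz.trans (mul_le_of_le_one_right' (pow_le_one₀ zero_le hθ1'))
    obtain ⟨Q, hQK, hQz⟩ := hlift r hrρ
    have hQρ : w Q.zCoord ≤ ρ := by rw [hQz]; exact hrρ
    have hQlev := hlev hQK hQρ
    have hSlev := hlev hSK hSz
    refine ⟨⟨(r - ℓ Q, S + Q), (kernel w V).add_mem hSK hQK, ?_, ?_, ?_⟩, ?_⟩
    · change w (S + Q).zCoord ≤ ρ
      exact (val_zCoord_add_le hSK hQK).trans (max_le hSz hQρ)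
    · -- the new residual: `|r − ℓ Q| = |ℓ Q − z Q| ≤ |z Q|²/|p|`
      change w (r - ℓ Q) ≤ ρ * θ ^ (k + 1)
      have e : r - ℓ Q = -(ℓ Q - Q.zCoord) := by rw [hQz]; ring
      rw [e, Valuation.map_neg]
      calc w (ℓ Q - Q.zCoord) ≤ w Q.zCoord ^ 2 / w (p : F) := val_limitLog_sub_zCoord_le hp0 hp1 hℓ hQlev
        _ ≤ (ρ * θ ^ k) ^ 2 / w (p : F) := by rw [hQz]; gcongr
        _ = ρ * θ ^ (k + 1) * θ ^ k := by
            rw [pow_two, pow_succ]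
            field_simp
            rw [hρθ]
            ring
        _ ≤ ρ * θ ^ (k + 1) * 1 := by gcongr; exact pow_le_one₀ zero_le hθ1'
        _ = ρ * θ ^ (k + 1) := mul_one _
    · change y = (r - ℓ Q) + ℓ (S + Q)
      rw [limitLog_add hp0 hp1 hℓ hSlev hQlev, hyS]; ring
    · change w ((S + Q).zCoord - S.zCoord) ≤ ρ * θ ^ k
      rw [val_zCoord_add_sub_eq hSK hQK, hQz]
      exact hrz
  choose next hnext using hstep
  -- the sequence of approximations; the partial sums' parameters are Cauchy
  let seq : ∀ k : ℕ, {s // Inv k s} := fun k ↦ Nat.rec ⟨(y, 0), hInv0⟩ (fun k s ↦ next k s) k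
  have hseq_succ : ∀ k, seq (k + 1) = next k (seq k) := fun k ↦ rfl
  have hseq_zero : (seq 0).1.2 = 0 := rfl
  have hcauchy : ∀ k, w ((seq (k + 1)).1.2.zCoord - (seq k).1.2.zCoord) ≤ ρ * θ ^ k := by
    intro k
    rw [hseq_succ]
    exact hnext k (seq k)
  obtain ⟨ylim, hylim⟩ := hcomplete (fun k ↦ (seq k).1.2.zCoord) ρ θ hθ1 hcauchy
  have hylim0 : w ylim ≤ ρ := by
    have h := hylim 0
    rw [hseq_zero, WeierstrassCurve.Affine.Point.zCoord_zero, sub_zero, pow_zero, mul_one] at h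
    exact h
  obtain ⟨P, hPK, hPz⟩ := hlift ylim hylim0
  have hPρ : w P.zCoord ≤ ρ := by rw [hPz]; exact hylim0
  refine ⟨P, hPK, hPρ, ?_⟩
  -- `|ℓ P − y| ≤ ρ θ^k` for every `k`
  have hsmall : ∀ k, w (ℓ P - y) ≤ ρ * θ ^ k := by
    intro k
    obtain ⟨hSK, hSz, hrz, hyS⟩ := (seq k).2
    have hSlev := hlev hSK hSz
    have hPlev := hlev hPK hPρ
    have hPSK : P - (seq k).1.2 ∈ kernel w V := (kernel w V).sub_mem hPK hSK
    have e : ℓ P - y = ℓ (P - (seq k).1.2) - (seq k).1.1 := by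
      rw [limitLog_sub hp0 hp1 hℓ hPlev hSlev, hyS]; ring
    rw [e]
    refine (Valuation.map_sub w _ _).trans (max_le ?_ hrz)
    have hPSlev : P - (seq k).1.2 ∈ level w V (w (p : F)) := (level w V (w (p : F))).sub_mem hPlev hSlev
    calc w (ℓ (P - (seq k).1.2)) ≤ w (P - (seq k).1.2).zCoord := val_limitLog_le hp0 hp1 hℓ hPSlev
      _ = w (P.zCoord - (seq k).1.2.zCoord) := (val_zCoord_sub hPK hSK).symm
      _ = w (ylim - (seq k).1.2.zCoord) := by rw [hPz]
      _ ≤ ρ * θ ^ k := hylim k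
  by_contra hne
  have hpos : 0 < w (ℓ P - y) := (Valuation.pos_iff w).mpr (sub_ne_zero.mpr hne)
  have hρ1 : ρ ≤ 1 := hρp.trans hp1.le
  obtain ⟨k, hk⟩ := exists_pow_lt_of_lt_one hpos hθ1
  exact lt_irrefl _ (((hsmall k).trans (mul_le_of_le_one_left' hρ1)).trans_lt hk)

/-- **`ℓ(U_ρ) = B_ρ` for `ρ ≤ |p|²`**: together with `|ℓ(Q)| = |z(Q)|` strictly inside the level
(`val_limitLog_eq_of_val_lt`), the logarithm maps `U_ρ = {Q ∈ E₁ : |z Q| ≤ ρ}` onto the ball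
`{y : |y| ≤ ρ}` (Silverman, *AEC* IV.6.4(b): `Ê(𝓜ʳ) ≅ 𝓜ʳ`). [cite: SilvermanAEC2009, Thm. IV.6.4(b)] -/
theorem image_limitLog_kernelLevel_eq (hp0 : (p : F) ≠ 0) (hp1 : w (p : F) < 1)
    (hℓ : ∀ Q ∈ level w V (w (p : F)), ∀ r : ℕ,
      w (ℓ Q - ((p ^ r) • Q).zCoord / (p : F) ^ r) ≤ w (p : F) ^ (r + 1))
    {ρ : ℝ≥0} (hρ : ρ ≤ w (p : F) ^ 2)
    (hlift : ∀ a : F, w a ≤ ρ → ∃ P ∈ kernel w V, P.zCoord = a)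
    (hcomplete : ∀ (x : ℕ → F) (C θ : ℝ≥0), θ < 1 → (∀ k, w (x (k + 1) - x k) ≤ C * θ ^ k) →
      ∃ y : F, ∀ k, w (y - x k) ≤ C * θ ^ k) :
    ℓ '' (kernelLevel w V ρ : Set V.toAffine.Point) = {y : F | w y ≤ ρ} := by
  have hp : 0 < w (p : F) := (Valuation.pos_iff w).mpr hp0
  have hρp : ρ < w (p : F) := hρ.trans_lt (by
    rw [pow_two]; exact mul_lt_of_lt_one_left hp hp1)
  ext y
  constructor
  · rintro ⟨Q, hQ, rfl⟩
    have hQ' := (mem_kernelLevel_iff (w := w) (V := V)).mp hQ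
    have hQlev : Q ∈ level w V (w (p : F)) := ⟨hQ'.1, hQ'.2.trans hρp.le⟩
    exact (val_limitLog_le hp0 hp1 hℓ hQlev).trans hQ'.2
  · intro hy
    obtain ⟨Q, hQK, hQz, hQy⟩ := exists_limitLog_eq_of_val_le hp0 hp1 hℓ hρ hlift hcomplete hy
    exact ⟨Q, (mem_kernelLevel_iff (w := w) (V := V)).mpr ⟨hQK, hQz⟩, hQy⟩

end Literature.NumberTheory.EllipticCurves.FormalGroupChart
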